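import Literature.Computability.Complexity.MonotoneSwitching
import Literature.Computability.Complexity.CliqueTestGraphs
import Literature.Computability.Complexity.CliqueCounting
import HarnessLib

/-!
# The two-sided approximation with local pairs at the leaves (Jukna 2012, §9.4, proof of Thm 9.17)

Everything in this file is PROVED. It runs the CNF/DNF approximation of Jukna 2012, Theorem 9.17
(`MonotoneSwitching.lean`: `ApproxInv`, `GateList.exists_approximators`) along a straight-line
program over `{∧₂, ∨₂, 0, 1}` whose `n` LEAVES are not variables but carry given local pairs
`Cl j ⊒ Dl j` (an `(s-1)`-CNF above an `(r-1)`-DNF over an arbitrary finite variable set `ι`),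
read through two valuations of the leaves, `cv` (leaf `j` is on whenever `Cl j` holds) and `dv`
(leaf `j` is on only if `Dl j` holds). The invariant of Thm 9.17 splits accordingly into a
lower half against `cv` and an upper half against `dv`; the AND/OR steps are those of
`ApproxInv.and_gate` / `ApproxInv.or_gate` verbatim (adapted from `MonotoneSwitching.lean`):

* `pairApprox_and_gate`, `pairApprox_or_gate` — one gate (Jukna 2012, Thm 9.17, Cases 2 and 3);
* `GateList.exists_pairApproximators`, `Circuit.exists_pairApproximators` — the whole program:
  an output pair of the same widths and global correcting families `Cf` (exact `s`-clauses,
  `≤ (r-1)^s` per gate) and `Df` (exact `r`-monomials, `≤ (s-1)^r` per gate) with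
  `Cf ∧ cnf ≤ Ψ ∘ cv` and `Ψ ∘ dv ≤ dnf ∨ Df`.

It also provides the two elementary MASS computations by which such correcting families are
charged as events (Jukna 2012, §9.8, proof of Thm 9.26, Case 1 counting, cf. `CliqueCounting`):

* `card_filter_supset_powersetCard_mul_pow_le` — `q`-sets containing a fixed `X`, times
  `c ^ #X`, are at most `n.choose q` (`q c ≤ n`);
* `card_filter_not_satClause_compl_mul_pow_le`, `card_filter_not_evalCNF_compl_mul_pow_le` — an
  exact `v`-clause (a family of them) is falsified by few complement vectors `e ↦ [e ∉ M]` of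
  `q`-sets `M`;
* `card_filter_satTerm_cliqueVec_mul_pow_le`, `card_filter_evalDNF_cliqueVec_mul_pow_le` — an
  exact monomial on more than `d.choose 2` edges (a family of them) holds on few clique vectors
  `cliqueVec K` of `k`-sets `K` (`CliqueTestGraphs.lean`).

## References

* S. Jukna, *Boolean Function Complexity: Advances and Frontiers*, Springer (2012), §9.4
  (Theorem 9.17, pp. 258–260) and §9.8 (Theorem 9.26, pp. 269–271) [Jukna2012].
-/

namespace Literature.Computability.Complexity

open Finset

open GateList

variable {ι : Type*} [Fintype ι] [DecidableEq ι]

/-- **AND step of the two-valued approximation invariant** (Jukna 2012, Thm 9.17, Case 2; lower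
half against one valuation, upper half against another): the left approximator of `u ∧ w` is the
union of the clause families, the right one comes from switching (`monotoneSwitching_cnf`), its
new errors corrected by `≤ (s-1)^r` exact `r`-monomials. [cite: Jukna2012, Thm. 9.17] -/
theorem pairApprox_and_gate {r s : ℕ} {Cf Df cu du cw dw : Finset (Finset ι)}
    {ulo uhi wlo whi : (ι → Bool) → Bool}
    (hcu : ∀ S ∈ cu, #S ≤ s - 1) (hcw : ∀ S ∈ cw, #S ≤ s - 1)
    (hu : ∀ x, EvalDNF du x → EvalCNF cu x) (hw : ∀ x, EvalDNF dw x → EvalCNF cw x)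
    (hul : ∀ x, EvalCNF Cf x → EvalCNF cu x → ulo x = true)
    (hwl : ∀ x, EvalCNF Cf x → EvalCNF cw x → wlo x = true)
    (huu : ∀ x, uhi x = true → EvalDNF du x ∨ EvalDNF Df x)
    (hwu : ∀ x, whi x = true → EvalDNF dw x ∨ EvalDNF Df x) :
    ∃ dn D' : Finset (Finset ι), (∀ P ∈ D', #P = r) ∧ #D' ≤ (s - 1) ^ r ∧
      (∀ S ∈ cu ∪ cw, #S ≤ s - 1) ∧ (∀ R ∈ dn, #R ≤ r - 1) ∧
      (∀ x, EvalDNF dn x → EvalCNF (cu ∪ cw) x) ∧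
      (∀ x, EvalCNF Cf x → EvalCNF (cu ∪ cw) x → (ulo x && wlo x) = true) ∧
      (∀ x, (uhi x && whi x) = true → EvalDNF dn x ∨ EvalDNF (Df ∪ D') x) := by
  have hwidth : ∀ S ∈ cu ∪ cw, #S ≤ s - 1 := fun S hS => by
    rcases Finset.mem_union.1 hS with hS | hS
    · exact hcu S hS
    · exact hcw S hS
  obtain ⟨dn, D', h1, h2, h3, h4, h5⟩ := monotoneSwitching_cnf (cu ∪ cw) s r hwidth
  refine ⟨dn, D', h2, h3, hwidth, h1, h4, fun x hx hcnf => ?_, fun x hx => ?_⟩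
  · rw [evalCNF_union] at hcnf
    rw [hul x hx hcnf.1, hwl x hx hcnf.2]; rfl
  · rw [Bool.and_eq_true] at hx
    rcases huu x hx.1 with hdu | hD
    · rcases hwu x hx.2 with hdw | hD
      · have hc : EvalCNF (cu ∪ cw) x := evalCNF_union.2 ⟨hu x hdu, hw x hdw⟩
        rcases h5 x hc with h | h
        · exact Or.inl h
        · exact Or.inr (h.mono Finset.subset_union_right)
      · exact Or.inr (hD.mono Finset.subset_union_left)
    · exact Or.inr (hD.mono Finset.subset_union_left)

/-- **OR step of the two-valued approximation invariant** (Jukna 2012, Thm 9.17, Case 3): the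
right approximator of `u ∨ w` is the union of the monomial families, the left one comes from
switching (`monotoneSwitching_dnf`), corrected by `≤ (r-1)^s` exact `s`-clauses. [cite: Jukna2012, Thm. 9.17] -/
theorem pairApprox_or_gate {r s : ℕ} {Cf Df cu du cw dw : Finset (Finset ι)}
    {ulo uhi wlo whi : (ι → Bool) → Bool}
    (hdu : ∀ R ∈ du, #R ≤ r - 1) (hdw : ∀ R ∈ dw, #R ≤ r - 1)
    (hu : ∀ x, EvalDNF du x → EvalCNF cu x) (hw : ∀ x, EvalDNF dw x → EvalCNF cw x)
    (hul : ∀ x, EvalCNF Cf x → EvalCNF cu x → ulo x = true)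
    (hwl : ∀ x, EvalCNF Cf x → EvalCNF cw x → wlo x = true)
    (huu : ∀ x, uhi x = true → EvalDNF du x ∨ EvalDNF Df x)
    (hwu : ∀ x, whi x = true → EvalDNF dw x ∨ EvalDNF Df x) :
    ∃ cn C' : Finset (Finset ι), (∀ P ∈ C', #P = s) ∧ #C' ≤ (r - 1) ^ s ∧
      (∀ S ∈ cn, #S ≤ s - 1) ∧ (∀ R ∈ du ∪ dw, #R ≤ r - 1) ∧
      (∀ x, EvalDNF (du ∪ dw) x → EvalCNF cn x) ∧
      (∀ x, EvalCNF (Cf ∪ C') x → EvalCNF cn x → (ulo x || wlo x) = true) ∧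
      (∀ x, (uhi x || whi x) = true → EvalDNF (du ∪ dw) x ∨ EvalDNF Df x) := by
  have hwidth : ∀ R ∈ du ∪ dw, #R ≤ r - 1 := fun R hR => by
    rcases Finset.mem_union.1 hR with hR | hR
    · exact hdu R hR
    · exact hdw R hR
  obtain ⟨cn, C', h1, h2, h3, h4, h5⟩ := monotoneSwitching_dnf (du ∪ dw) r s hwidth
  refine ⟨cn, C', h2, h3, h1, hwidth, h4, fun x hx hcnf => ?_, fun x hx => ?_⟩
  · rw [evalCNF_union] at hx
    have hd : EvalDNF (du ∪ dw) x := h5 x hcnf hx.2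
    rcases evalDNF_union.1 hd with hd | hd
    · rw [hul x hx.1 (hu x hd)]; rfl
    · rw [hwl x hx.1 (hw x hd)]; simp
  · rw [Bool.or_eq_true] at hx
    rcases hx with hx | hx
    · rcases huu x hx with h | h
      · exact Or.inl (h.mono Finset.subset_union_left)
      · exact Or.inr h
    · rcases hwu x hx with h | h
      · exact Or.inl (h.mono Finset.subset_union_right)
      · exact Or.inr h

/-- **Two-valued approximators along a straight-line program** (Jukna 2012, proof of Thm 9.17,
run with local pairs at the leaves): along a well-formed program over `{∧₂, ∨₂, 0, 1}` on `n`
leaves, leaf `j` carrying the pair `(Cl j, Dl j)` (an `(s-1)`-CNF above an `(r-1)`-DNF) and two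
valuations `cv` (leaf `j` on whenever `Cl j` holds) and `dv` (leaf `j` on only if `Dl j` holds),
every wire `w` gets a pair `(ap w).1 ⊒ (ap w).2` of the same widths with
`Cf ∧ (ap w).1 ≤ w(cv x)` and `w(dv x) ≤ (ap w).2 ∨ Df`, for global correcting families `Cf`
(exact `s`-clauses, `≤ (r-1)^s` per gate) and `Df` (exact `r`-monomials, `≤ (s-1)^r` per gate).
[cite: Jukna2012, Thm. 9.17] -/
theorem GateList.exists_pairApproximators {n r s : ℕ} (Dl Cl : Fin n → Finset (Finset ι))
    (cv dv : (ι → Bool) → Fin n → Bool)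
    (hDl : ∀ j, ∀ R ∈ Dl j, #R ≤ r - 1) (hCl : ∀ j, ∀ S ∈ Cl j, #S ≤ s - 1)
    (hle : ∀ j x, EvalDNF (Dl j) x → EvalCNF (Cl j) x)
    (hcv : ∀ j x, EvalCNF (Cl j) x → cv x j = true)
    (hdv : ∀ j x, dv x j = true → EvalDNF (Dl j) x) :
    ∀ gs : List (Gate (Fin n)), WF gs → (∀ g ∈ gs, g.fn ∈ monotoneBasis01) →
      ∃ (ap : Fin n ⊕ ℕ → Finset (Finset ι) × Finset (Finset ι)) (Cf Df : Finset (Finset ι)),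
        (∀ P ∈ Cf, #P = s) ∧ (∀ P ∈ Df, #P = r) ∧
        #Cf ≤ gs.length * (r - 1) ^ s ∧ #Df ≤ gs.length * (s - 1) ^ r ∧
        ∀ w : Fin n ⊕ ℕ, OutOK gs.length w →
          (∀ S ∈ (ap w).1, #S ≤ s - 1) ∧ (∀ R ∈ (ap w).2, #R ≤ r - 1) ∧
          (∀ x, EvalDNF (ap w).2 x → EvalCNF (ap w).1 x) ∧
          (∀ x, EvalCNF Cf x → EvalCNF (ap w).1 x → wireOf (cv x) (vals gs (cv x)) w = true) ∧
          (∀ x, wireOf (dv x) (vals gs (dv x)) w = true → EvalDNF (ap w).2 x ∨ EvalDNF Df x) := by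
  intro gs
  induction gs using List.reverseRecOn with
  | nil =>
    intro _ _
    refine ⟨fun w => match w with
      | .inl j => (Cl j, Dl j)
      | .inr _ => (∅, ∅), ∅, ∅, by simp, by simp, by simp, by simp, fun w hw => ?_⟩
    rcases w with j | m
    · exact ⟨hCl j, hDl j, hle j, fun x _ hx => hcv j x hx, fun x hx => Or.inl (hdv j x hx)⟩
    · exact absurd (hw m rfl) (by simp)
  | append_singleton gs g ih =>
    intro hwf hB
    obtain ⟨ap, Cf, Df, hCf, hDf, hcC, hcD, hinv⟩ :=
      ih hwf.of_append_left fun g hg => hB g (List.mem_append_left _ hg)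
    have hgOK : GateOK gs.length g := hwf.gateOK_mid (post := [])
    have hgB : g.fn ∈ monotoneBasis01 := hB g (by simp)
    have hold : ∀ (Cf' Df' : Finset (Finset ι)), Cf ⊆ Cf' → Df ⊆ Df' → ∀ w : Fin n ⊕ ℕ,
        OutOK gs.length w →
          (∀ S ∈ (ap w).1, #S ≤ s - 1) ∧ (∀ R ∈ (ap w).2, #R ≤ r - 1) ∧
          (∀ x, EvalDNF (ap w).2 x → EvalCNF (ap w).1 x) ∧
          (∀ x, EvalCNF Cf' x → EvalCNF (ap w).1 x →
            wireOf (cv x) (vals (gs ++ [g]) (cv x)) w = true) ∧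
          (∀ x, wireOf (dv x) (vals (gs ++ [g]) (dv x)) w = true →
            EvalDNF (ap w).2 x ∨ EvalDNF Df' x) := by
      intro Cf' Df' hC' hD' w hw
      obtain ⟨h1, h2, h3, h4, h5⟩ := hinv w hw
      refine ⟨h1, h2, h3, fun x hx hc => ?_, fun x hx => ?_⟩
      · rw [wireOf_vals_append gs [g] _ w hw]
        exact h4 x (hx.anti hC') hc
      · rw [wireOf_vals_append gs [g] _ w hw] at hx
        exact (h5 x hx).imp_right fun hd => hd.mono hD'
    have hnew : ∀ y : Fin n → Bool, wireOf y (vals (gs ++ [g]) y) (.inr gs.length) =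
        g.op (fun a => wireOf y (vals gs y) (g.args a)) := fun y => by
      rw [wireOf_inr, show gs ++ [g] = gs ++ g :: [] from rfl, getD_vals_append_cons]
    have assemble : ∀ (Cf' Df' cn dn : Finset (Finset ι)),
        Cf ⊆ Cf' → Df ⊆ Df' → (∀ P ∈ Cf', #P = s) → (∀ P ∈ Df', #P = r) →
        #Cf' ≤ (gs ++ [g]).length * (r - 1) ^ s → #Df' ≤ (gs ++ [g]).length * (s - 1) ^ r →
        (∀ S ∈ cn, #S ≤ s - 1) → (∀ R ∈ dn, #R ≤ r - 1) →
        (∀ x, EvalDNF dn x → EvalCNF cn x) →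
        (∀ x, EvalCNF Cf' x → EvalCNF cn x →
          wireOf (cv x) (vals (gs ++ [g]) (cv x)) (.inr gs.length) = true) →
        (∀ x, wireOf (dv x) (vals (gs ++ [g]) (dv x)) (.inr gs.length) = true →
          EvalDNF dn x ∨ EvalDNF Df' x) →
        ∃ (ap : Fin n ⊕ ℕ → Finset (Finset ι) × Finset (Finset ι)) (Cf Df : Finset (Finset ι)),
          (∀ P ∈ Cf, #P = s) ∧ (∀ P ∈ Df, #P = r) ∧
          #Cf ≤ (gs ++ [g]).length * (r - 1) ^ s ∧ #Df ≤ (gs ++ [g]).length * (s - 1) ^ r ∧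
          ∀ w : Fin n ⊕ ℕ, OutOK (gs ++ [g]).length w →
            (∀ S ∈ (ap w).1, #S ≤ s - 1) ∧ (∀ R ∈ (ap w).2, #R ≤ r - 1) ∧
            (∀ x, EvalDNF (ap w).2 x → EvalCNF (ap w).1 x) ∧
            (∀ x, EvalCNF Cf x → EvalCNF (ap w).1 x →
              wireOf (cv x) (vals (gs ++ [g]) (cv x)) w = true) ∧
            (∀ x, wireOf (dv x) (vals (gs ++ [g]) (dv x)) w = true →
              EvalDNF (ap w).2 x ∨ EvalDNF Df x) := by
      intro Cf' Df' cn dn hCC' hDD' hC' hD' hcC' hcD' hw1 hw2 hw3 hw4 hw5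
      refine ⟨fun w => if w = .inr gs.length then (cn, dn) else ap w, Cf', Df', hC', hD', hcC',
        hcD', fun w hw => ?_⟩
      by_cases hwn : w = .inr gs.length
      · subst hwn
        simp only [if_true]
        exact ⟨hw1, hw2, hw3, hw4, hw5⟩
      · dsimp only
        rw [if_neg hwn]
        refine hold Cf' Df' hCC' hDD' w fun m hm => ?_
        have h1 := hw m hm
        simp only [List.length_append, List.length_singleton] at h1
        have h2 : m ≠ gs.length := fun h => hwn (hm.trans (by rw [h]))
        omega
    have hlen : (gs ++ [g]).length = gs.length + 1 := by simp
    simp only [monotoneBasis01, monotoneBasis, Set.mem_insert_iff, Set.mem_singleton_iff] at hgB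
    rcases hgB with hc | hc | hc | hc
    · -- constant `1`
      have hg := exists_eq_constGate_of_fn_eq hc
      subst hg
      refine assemble Cf Df ∅ {∅} Finset.Subset.rfl Finset.Subset.rfl hCf hDf
        (hcC.trans (Nat.mul_le_mul_right _ (by simp))) (hcD.trans (Nat.mul_le_mul_right _ (by simp)))
        (by simp) (fun R hR => by rw [Finset.mem_singleton.1 hR]; simp) (fun x _ => evalCNF_empty)
        (fun x _ _ => by rw [hnew]; rfl) (fun x _ => Or.inl evalDNF_singleton_empty)
    · -- constant `0`
      have hg := exists_eq_constGate_of_fn_eq hc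
      subst hg
      refine assemble Cf Df {∅} ∅ Finset.Subset.rfl Finset.Subset.rfl hCf hDf
        (hcC.trans (Nat.mul_le_mul_right _ (by simp))) (hcD.trans (Nat.mul_le_mul_right _ (by simp)))
        (fun S hS => by rw [Finset.mem_singleton.1 hS]; simp) (by simp)
        (fun x hx => absurd hx not_evalDNF_empty)
        (fun x _ hx => absurd hx not_evalCNF_singleton_empty) (fun x hx => ?_)
      rw [hnew] at hx
      exact absurd hx Bool.false_ne_true
    · -- AND gate
      obtain ⟨u, v, rfl⟩ := exists_eq_andGate_of_fn_eq hc
      have hu : OutOK gs.length u := fun m hm => hgOK (0 : Fin 2) m hm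
      have hv : OutOK gs.length v := fun m hm => hgOK (1 : Fin 2) m hm
      obtain ⟨hu1, -, hu3, hu4, hu5⟩ := hinv u hu
      obtain ⟨hv1, -, hv3, hv4, hv5⟩ := hinv v hv
      obtain ⟨dn, D', hD', hcD', h1, h2, h3, h4, h5⟩ := pairApprox_and_gate hu1 hv1 hu3 hv3 hu4 hv4 hu5 hv5
      have hcDu : #(Df ∪ D') ≤ (gs.length + 1) * (s - 1) ^ r :=
        calc #(Df ∪ D') ≤ #Df + #D' := Finset.card_union_le _ _
          _ ≤ gs.length * (s - 1) ^ r + (s - 1) ^ r := Nat.add_le_add hcD hcD'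
          _ = (gs.length + 1) * (s - 1) ^ r := by ring
      refine assemble Cf (Df ∪ D') _ dn Finset.Subset.rfl Finset.subset_union_left hCf
        (fun P hP => ?_) (hcC.trans (Nat.mul_le_mul_right _ (by simp))) (by rw [hlen]; exact hcDu)
        h1 h2 h3 (fun x hx hcn => ?_) (fun x hx => ?_)
      · rcases Finset.mem_union.1 hP with hP | hP
        · exact hDf P hP
        · exact hD' P hP
      · rw [hnew, andGate_op]
        exact h4 x hx hcn
      · rw [hnew, andGate_op] at hx
        exact h5 x hx
    · -- OR gate
      obtain ⟨u, v, rfl⟩ := exists_eq_orGate_of_fn_eq hc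
      have hu : OutOK gs.length u := fun m hm => hgOK (0 : Fin 2) m hm
      have hv : OutOK gs.length v := fun m hm => hgOK (1 : Fin 2) m hm
      obtain ⟨-, hu2, hu3, hu4, hu5⟩ := hinv u hu
      obtain ⟨-, hv2, hv3, hv4, hv5⟩ := hinv v hv
      obtain ⟨cn, C', hC', hcC', h1, h2, h3, h4, h5⟩ := pairApprox_or_gate hu2 hv2 hu3 hv3 hu4 hv4 hu5 hv5
      have hcCu : #(Cf ∪ C') ≤ (gs.length + 1) * (r - 1) ^ s :=
        calc #(Cf ∪ C') ≤ #Cf + #C' := Finset.card_union_le _ _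
          _ ≤ gs.length * (r - 1) ^ s + (r - 1) ^ s := Nat.add_le_add hcC hcC'
          _ = (gs.length + 1) * (r - 1) ^ s := by ring
      refine assemble (Cf ∪ C') Df cn _ Finset.subset_union_left Finset.Subset.rfl
        (fun P hP => ?_) hDf (by rw [hlen]; exact hcCu) (hcD.trans (Nat.mul_le_mul_right _ (by simp)))
        h1 h2 h3 (fun x hx hcn => ?_) (fun x hx => ?_)
      · rcases Finset.mem_union.1 hP with hP | hP
        · exact hCf P hP
        · exact hC' P hP
      · rw [hnew, orGate_op]
        exact h4 x hx hcn
      · rw [hnew, orGate_op] at hx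
        exact h5 x hx

/-- **Two-valued approximation of a `{∧₂, ∨₂, 0, 1}`-circuit fed with local pairs** (Jukna 2012,
Thm 9.17 through the circuit `Ψ` with the pairs `(Cl j, Dl j)` as leaves): there is an output
pair `cnf ⊒ dnf` of the same widths and global correcting families `Cf` (`≤ |Ψ| (r-1)^s` exact
`s`-clauses) and `Df` (`≤ |Ψ| (s-1)^r` exact `r`-monomials) with `Cf ∧ cnf ≤ Ψ ∘ cv` and
`Ψ ∘ dv ≤ dnf ∨ Df`. [cite: Jukna2012, Thm. 9.17] -/
theorem Circuit.exists_pairApproximators {n r s : ℕ} (Dl Cl : Fin n → Finset (Finset ι))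
    (cv dv : (ι → Bool) → Fin n → Bool)
    (hDl : ∀ j, ∀ R ∈ Dl j, #R ≤ r - 1) (hCl : ∀ j, ∀ S ∈ Cl j, #S ≤ s - 1)
    (hle : ∀ j x, EvalDNF (Dl j) x → EvalCNF (Cl j) x)
    (hcv : ∀ j x, EvalCNF (Cl j) x → cv x j = true)
    (hdv : ∀ j x, dv x j = true → EvalDNF (Dl j) x)
    (Ψ : Circuit (Fin n)) (hΨ : Ψ.IsOver monotoneBasis01) :
    ∃ dnf cnf Cf Df : Finset (Finset ι),
      (∀ R ∈ dnf, #R ≤ r - 1) ∧ (∀ S ∈ cnf, #S ≤ s - 1) ∧ (∀ x, EvalDNF dnf x → EvalCNF cnf x) ∧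
      (∀ P ∈ Cf, #P = s) ∧ (∀ P ∈ Df, #P = r) ∧
      #Cf ≤ Ψ.size * (r - 1) ^ s ∧ #Df ≤ Ψ.size * (s - 1) ^ r ∧
      (∀ x, EvalCNF Cf x → EvalCNF cnf x → Ψ.eval (cv x) = true) ∧
      (∀ x, Ψ.eval (dv x) = true → EvalDNF dnf x ∨ EvalDNF Df x) := by
  obtain ⟨ap, Cf, Df, hCf, hDf, hcC, hcD, hinv⟩ :=
    GateList.exists_pairApproximators Dl Cl cv dv hDl hCl hle hcv hdv Ψ.gates (wf_gates Ψ) hΨ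
  obtain ⟨h1, h2, h3, h4, h5⟩ := hinv Ψ.output Ψ.wf_output
  refine ⟨(ap Ψ.output).2, (ap Ψ.output).1, Cf, Df, h2, h1, h3, hCf, hDf, hcC, hcD,
    fun x hx hc => ?_, fun x hx => ?_⟩
  · rw [circuit_eval]; exact h4 x hx hc
  · rw [circuit_eval] at hx; exact h5 x hx

/-- The `q`-subsets of a finite type containing a fixed set `X`, weighted by `c ^ #X`, number at
most `n.choose q` when `q c ≤ n`, `c ≥ 1` — and none at all if `#X > q` (Jukna 2012, Thm 9.26,
Case 1 count, `choose_sub_mul_pow_le`). [cite: Jukna2012, Thm. 9.26] -/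
theorem card_filter_supset_powersetCard_mul_pow_le {α : Type*} [Fintype α] [DecidableEq α] {q c : ℕ}
    (hc : 1 ≤ c) (hqc : q * c ≤ Fintype.card α) (X : Finset α) :
    #((powersetCard q (univ : Finset α)).filter fun Q => X ⊆ Q) * c ^ #X ≤
      (Fintype.card α).choose q := by
  rcases le_or_gt #X q with hXq | hXq
  · calc _ ≤ (#(univ : Finset α) - #X).choose (q - #X) * c ^ #X :=
          Nat.mul_le_mul_right _ (card_filter_supset_powersetCard_le _ _ hXq)
      _ = (Fintype.card α - #X).choose (q - #X) * c ^ #X := by rw [Finset.card_univ]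
      _ ≤ _ := choose_sub_mul_pow_le hc hXq hqc
  · rw [Finset.filter_false_of_mem, Finset.card_empty, zero_mul]
    · exact Nat.zero_le _
    · intro Q hQ hXQ
      have := card_le_card hXQ
      rw [(mem_powersetCard.1 hQ).2] at this
      omega

/-- **Mass of an exact clause on the negatives.** The complement vector `e ↦ [e ∉ M]` of a
`q`-set `M` falsifies the monotone clause `⋁_{e ∈ S} x_e` only if `S ⊆ M`; hence among the
`q`-subsets of an `n`-set at most `n.choose q / c ^ v` (for `#S = v`, `q c ≤ n`, `c ≥ 1`) do.
[cite: Jukna2012, Thm. 9.26] -/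
theorem card_filter_not_satClause_compl_mul_pow_le {ι : Type*} [Fintype ι] [DecidableEq ι] {q c v : ℕ}
    (hc : 1 ≤ c) (hqc : q * c ≤ Fintype.card ι) (S : Finset ι) (hS : #S = v)
    [DecidablePred fun M : Finset ι => ¬ SatClause S (fun e => decide (e ∉ M))] :
    #((powersetCard q (univ : Finset ι)).filter fun M => ¬ SatClause S (fun e => decide (e ∉ M)))
      * c ^ v ≤ (Fintype.card ι).choose q := by
  subst hS
  refine le_trans (Nat.mul_le_mul_right _ (card_le_card fun M hM => ?_))
    (card_filter_supset_powersetCard_mul_pow_le hc hqc S)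
  rw [Finset.mem_filter] at hM ⊢
  refine ⟨hM.1, fun e he => ?_⟩
  by_contra heM
  exact hM.2 ⟨e, he, by simp [heM]⟩

/-- **Mass of a family of exact clauses on the negatives** (union bound over
`card_filter_not_satClause_compl_mul_pow_le`): the `q`-sets whose complement vector falsifies the exact
`v`-CNF `Cf` number at most `#Cf · n.choose q / c ^ v`. [cite: Jukna2012, Thm. 9.26] -/
theorem card_filter_not_evalCNF_compl_mul_pow_le {ι : Type*} [Fintype ι] [DecidableEq ι] {q c v : ℕ}
    (hc : 1 ≤ c) (hqc : q * c ≤ Fintype.card ι) (Cf : Finset (Finset ι)) (hCf : ∀ S ∈ Cf, #S = v)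
    [DecidablePred fun M : Finset ι => ¬ EvalCNF Cf (fun e => decide (e ∉ M))] :
    #((powersetCard q (univ : Finset ι)).filter fun M => ¬ EvalCNF Cf (fun e => decide (e ∉ M)))
      * c ^ v ≤ #Cf * (Fintype.card ι).choose q := by
  classical
  have hsub : ((powersetCard q (univ : Finset ι)).filter
      fun M => ¬ EvalCNF Cf (fun e => decide (e ∉ M))) ⊆
      Cf.biUnion fun S => (powersetCard q univ).filter
        fun M => ¬ SatClause S (fun e => decide (e ∉ M)) := by
    intro M hM
    rw [Finset.mem_filter] at hM
    obtain ⟨S, hS, hSM⟩ : ∃ S ∈ Cf, ¬ SatClause S (fun e => decide (e ∉ M)) := by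
      by_contra hno
      push Not at hno
      exact hM.2 hno
    exact Finset.mem_biUnion.2 ⟨S, hS, Finset.mem_filter.2 ⟨hM.1, hSM⟩⟩
  have hb : #(Cf.biUnion fun S => (powersetCard q univ).filter
      fun M => ¬ SatClause S (fun e => decide (e ∉ M))) ≤ #Cf * ((Fintype.card ι).choose q / c ^ v) :=
    Finset.card_biUnion_le_card_mul _ _ _ fun S hS =>
      (Nat.le_div_iff_mul_le (Nat.pow_pos hc)).2
        (card_filter_not_satClause_compl_mul_pow_le hc hqc S (hCf S hS))
  calc _ ≤ #Cf * ((Fintype.card ι).choose q / c ^ v) * c ^ v :=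
        Nat.mul_le_mul_right _ ((card_le_card hsub).trans hb)
    _ = #Cf * ((Fintype.card ι).choose q / c ^ v * c ^ v) := by ring
    _ ≤ #Cf * (Fintype.card ι).choose q := Nat.mul_le_mul_left _ (Nat.div_mul_le_self _ _)

/-- **Mass of an exact monomial on the positives.** An exact monomial `R` of more than
`d.choose 2` edge variables spans at least `d` vertices (`le_card_edgeVerts`), and the clique
vector of a `k`-set `K` satisfies it only if `K` contains all of them; hence at most
`m.choose k / Q ^ d` of the `k`-sets do, whenever `k Q ≤ m`, `Q ≥ 1` (Jukna 2012, Thm 9.26,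
Case 1). [cite: Jukna2012, Thm. 9.26] -/
theorem card_filter_satTerm_cliqueVec_mul_pow_le {m k Q d : ℕ} (hQ : 1 ≤ Q) (hkQ : k * Q ≤ m)
    (R : Finset ((⊤ : SimpleGraph (Fin m)).edgeSet)) (hR : d.choose 2 < #R)
    [DecidablePred fun K : Finset (Fin m) => SatTerm R (cliqueVec K)] :
    #((powersetCard k (univ : Finset (Fin m))).filter fun K => SatTerm R (cliqueVec K)) * Q ^ d
      ≤ m.choose k := by
  set V : Finset (Fin m) := edgeVerts (R.image Subtype.val)
  have hdV : d ≤ #V :=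
    le_card_edgeVerts (by rwa [Finset.card_image_of_injective _ Subtype.val_injective])
  have key := card_filter_supset_powersetCard_mul_pow_le hQ (by simpa using hkQ) V
  simp only [Fintype.card_fin] at key
  refine le_trans (Nat.mul_le_mul (card_le_card fun K hK => ?_) (Nat.pow_le_pow_right hQ hdV)) key
  rw [Finset.mem_filter] at hK ⊢
  refine ⟨hK.1, edgeVerts_subset fun e he v hv => ?_⟩
  obtain ⟨e', he', rfl⟩ := Finset.mem_image.1 he
  have := hK.2 e' he'
  simp only [cliqueVec, decide_eq_true_eq] at this
  exact this v hv

/-- **Mass of a family of exact monomials on the positives** (union bound over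
`card_filter_satTerm_cliqueVec_mul_pow_le`): the `k`-sets whose clique vector satisfies the exact
DNF `Df` (all monomials of more than `d.choose 2` edges) number at most `#Df · m.choose k / Q ^ d`.
[cite: Jukna2012, Thm. 9.26] -/
theorem card_filter_evalDNF_cliqueVec_mul_pow_le {m k Q d : ℕ} (hQ : 1 ≤ Q) (hkQ : k * Q ≤ m)
    (Df : Finset (Finset ((⊤ : SimpleGraph (Fin m)).edgeSet))) (hDf : ∀ R ∈ Df, d.choose 2 < #R)
    [DecidablePred fun K : Finset (Fin m) => EvalDNF Df (cliqueVec K)] :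
    #((powersetCard k (univ : Finset (Fin m))).filter fun K => EvalDNF Df (cliqueVec K)) * Q ^ d
      ≤ #Df * m.choose k := by
  classical
  have hsub : ((powersetCard k (univ : Finset (Fin m))).filter fun K => EvalDNF Df (cliqueVec K)) ⊆
      Df.biUnion fun R => (powersetCard k univ).filter fun K => SatTerm R (cliqueVec K) := by
    intro K hK
    rw [Finset.mem_filter] at hK
    obtain ⟨R, hR, hRK⟩ := hK.2
    exact Finset.mem_biUnion.2 ⟨R, hR, Finset.mem_filter.2 ⟨hK.1, hRK⟩⟩
  have hb : #(Df.biUnion fun R => (powersetCard k univ).filter fun K => SatTerm R (cliqueVec K)) ≤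
      #Df * (m.choose k / Q ^ d) :=
    Finset.card_biUnion_le_card_mul _ _ _ fun R hR =>
      (Nat.le_div_iff_mul_le (Nat.pow_pos hQ)).2
        (card_filter_satTerm_cliqueVec_mul_pow_le hQ hkQ R (hDf R hR))
  calc _ ≤ #Df * (m.choose k / Q ^ d) * Q ^ d :=
        Nat.mul_le_mul_right _ ((card_le_card hsub).trans hb)
    _ = #Df * (m.choose k / Q ^ d * Q ^ d) := by ring
    _ ≤ #Df * m.choose k := Nat.mul_le_mul_left _ (Nat.div_mul_le_self _ _)

end Literature.Computability.Complexity
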